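import Mathlib
import Literature.Analysis.PDE.WeakBVStrongTraces
import HarnessLib

/-!
# The cell inequality of Chen–Krupa–Vasseur with Lipschitz fronts (proofs)

Topic `Literature/Analysis/PDE`; continuation of `WeakBVStrongTraces.lean` (the strong-trace
calculus of the printed proof of [ChenKrupaVasseur2022], Thm 1.3: traces of observables, kernel
traces, the cell inequality `cellIneq_of_strongTraces` / `cellIneq_relEntropy` between SMOOTH
fronts, one-sided limits at interaction times). Definition 1.2 of the paper asks for strong traces
along "any Lipschitzian curve", and the fronts along which (3.1) is integrated in §7 are the
Lipschitz shifts `h_i` of Prop. 4.1; this file removes the smoothness restriction on the fronts.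
Everything is proved; no named facts.

* section `LipschitzMollification` — `exists_smooth_approx_lipschitz`: the one-sided
  mollifications `g_k = (kK(k·)) ⋆ h` (`K = smoothTransition'`) of a `K`-Lipschitz `h : ℝ → ℝ` are
  smooth, `K`-Lipschitz, `O(1/k)`-close to `h`, and `g_k'(x) → h'(x)` at every point of
  differentiability of `h` (hence a.e., `LipschitzWith.ae_differentiableAt_real`).
* section `TraceTransfer` — `tendsto_lintegral_enorm_trace_sub_of_approx_right/left`: strong
  traces (Def. 1.2) of `u` along curves `a ≤ a_j ≤ a + d_j` (`b - d_j ≤ b_j ≤ b`), `d_j → 0`,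
  converge in `L¹(0,T)` to the right trace along `a` (left trace along `b`).
* section `LipschitzFronts` — `tendsto_lintegral_enorm_comp_sub_of_uniformContinuousOn`
  (`L¹`-convergence passes to bounded uniformly continuous observables),
  `uniformContinuousOn_relEntropyObs`, `uniformContinuousOn_relFluxObs`, `exists_bound_relObs`
  (the relative quantities `η(·|c)`, `q(·;c)` of §3 are uniformly continuous and bounded where
  `η, q, f` are), and the main result `cellIneq_relEntropy_lipschitz`: for `u` jointly measurable,
  valued in a bounded `𝒰₀` for `t > 0`, with strong traces along every Lipschitz curve
  (`HasStrongTraces u`, as for `u ∈ 𝒮_weak`), satisfying (3.1) for the constant state `c` and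
  vector `π`, and Lipschitz fronts `a < b` on `(S,T)` with right/left traces `ua`, `ub`: off a
  null set of times, for `S < s < t < T`,
  `∫_{a(t)}^{b(t)} η(u(t,x)|c) dx ≤ ∫_{a(s)}^{b(s)} η(u(s,x)|c) dx + ∫_s^t (F⁺_a − F⁻_b) dr`,
  `F⁺_a = q(ua;c) − a'η(ua|c)`, `F⁻_b = q(ub;c) − b'η(ub|c)` (`a', b'` the a.e. derivatives) —
  the displayed cell estimate of §7 (fluxes `F_i^±`) for one cell, constant weight dropped.
  Proof: smooth fronts `a ≤ a_j`, `b_j ≤ b`, `cellIneq_relEntropy` on compact sub-intervals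
  (countably many null sets), trace transfer, `a_j' → a'` a.e. and dominated convergence.

## References

* G. Chen, S. G. Krupa, A. F. Vasseur, *Uniqueness and weak-BV stability for `2 × 2` conservation
  laws*, Arch. Ration. Mech. Anal. 246 (2022) 299–332, doi:10.1007/s00205-022-01813-0;
  arXiv:2010.04761 (numbering used): Def. 1.2, §3 (3.1), Prop. 4.1, §7 (the cell estimate with
  fluxes `F_i^±` along the shifts `h_i`) [ChenKrupaVasseur2022].
-/

noncomputable section

open MeasureTheory Set Filter Bornology
open scoped Topology ENNReal

namespace Literature.Analysis.PDE

open Literature.Analysis.Calculus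

variable {n : ℕ}

/-! ## Smoothing of Lipschitz fronts -/

section LipschitzMollification

open scoped Convolution NNReal

/-- `K = smoothTransition'` is smooth. [folklore] -/
theorem contDiff_deriv_smoothTransition' :
    ContDiff ℝ (⊤ : ℕ∞) (deriv Real.smoothTransition) :=
  (contDiff_infty_iff_deriv.1 Real.smoothTransition.contDiff).2

/-- `K'' = smoothTransition''` vanishes off `[0,1]`. [folklore] -/
theorem deriv_deriv_smoothTransition_eq_zero {y : ℝ} (hy : y < 0 ∨ 1 < y) :
    deriv (deriv Real.smoothTransition) y = 0 := by
  have hev : deriv Real.smoothTransition =ᶠ[𝓝 y] fun _ => (0 : ℝ) := by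
    rcases hy with hy | hy
    · filter_upwards [Iio_mem_nhds hy] with z hz
      exact deriv_smoothTransition_of_nonpos (le_of_lt hz)
    · filter_upwards [Ioi_mem_nhds hy] with z hz
      exact deriv_smoothTransition_of_one_le (le_of_lt hz)
  rw [hev.deriv_eq, deriv_const]

/-- **One-sided mollification of a Lipschitz function.** For `h` Lipschitz with constant `K` on
`ℝ`, the smooth functions `g_k(x) = ∫ (k+1) K((k+1)t) h(x-t) dt` (averages of `h` over
`[x - 1/(k+1), x]` against the kernel `K = smoothTransition'`) are `K`-Lipschitz, uniformly
`O(1/k)`-close to `h`, and their derivatives converge to `h'` at every point of differentiability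
of `h` (hence a.e., by Rademacher's theorem `LipschitzWith.ae_differentiableAt_real`). Used to
pass from smooth to Lipschitz fronts (the shifts `h_i` of Prop. 4.1 are merely Lipschitz).
[folklore] -/
theorem exists_smooth_approx_lipschitz {h : ℝ → ℝ} {K : ℝ≥0} (hh : LipschitzWith K h) :
    ∃ g : ℕ → ℝ → ℝ,
      (∀ k, ContDiff ℝ (⊤ : ℕ∞) (g k)) ∧
      (∀ k, LipschitzWith K (g k)) ∧
      (∃ C, ∀ k x, |g k x - h x| ≤ C / ((k : ℝ) + 1)) ∧
      (∀ x, DifferentiableAt ℝ h x →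
        Tendsto (fun k => deriv (g k) x) atTop (𝓝 (deriv h x))) := by
  obtain ⟨D, hD1, hD⟩ := exists_one_le_bound_deriv_smoothTransition
  have hD0 : 0 ≤ D := zero_le_one.trans hD1
  have hK0 : (0 : ℝ) ≤ K := K.2
  have hhc : Continuous h := hh.continuous
  have hhli : LocallyIntegrable h := hhc.locallyIntegrable
  -- `K'`: continuous, compactly supported, bounded by `D₂`
  have hK1s : HasCompactSupport (deriv Real.smoothTransition) :=
    HasCompactSupport.intro isCompact_Icc fun y hy =>
      deriv_smoothTransition_eq_zero_of_not_mem fun h' => hy (Ioo_subset_Icc_self h')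
  have hK2c : Continuous (deriv (deriv Real.smoothTransition)) :=
    contDiff_deriv_smoothTransition'.continuous_deriv (by exact_mod_cast le_top)
  have hK2s : HasCompactSupport (deriv (deriv Real.smoothTransition)) := hK1s.deriv
  obtain ⟨D₂, hD₂⟩ := hK2s.exists_bound_of_continuous hK2c
  have hD₂0 : 0 ≤ D₂ := (norm_nonneg _).trans (hD₂ 0)
  have hK1d : ∀ y, HasDerivAt (deriv Real.smoothTransition)
      (deriv (deriv Real.smoothTransition) y) y := fun y =>
    ((contDiff_deriv_smoothTransition'.differentiable (by simp)) y).hasDerivAt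
  -- the kernels `f k t = c K(c t)`, `c = k + 1`, and their derivatives
  set c : ℕ → ℝ := fun k => (k : ℝ) + 1 with hc
  have hc0 : ∀ k, 0 < c k := fun k => by simp only [hc]; positivity
  set f : ℕ → ℝ → ℝ := fun k t => c k * deriv Real.smoothTransition (c k * t) with hf
  have hfK : ∀ k, ContDiff ℝ (⊤ : ℕ∞) (f k) := fun k =>
    contDiff_const.mul (contDiff_deriv_smoothTransition'.comp (contDiff_const.mul contDiff_id))
  have hfc : ∀ k, Continuous (f k) := fun k => (hfK k).continuous
  have hfs : ∀ k, HasCompactSupport (f k) := fun k =>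
    HasCompactSupport.intro isCompact_Icc fun t ht =>
      rightKernel_eq_zero (hc0 k) fun h' => ht (Ioo_subset_Icc_self h')
  have hf0 : ∀ k t, 0 ≤ f k t := fun k t =>
    mul_nonneg (hc0 k).le Real.smoothTransition.monotone.deriv_nonneg
  have hfz : ∀ k t, t ∉ Ioo (0 : ℝ) (1 / c k) → f k t = 0 := fun k t ht =>
    rightKernel_eq_zero (hc0 k) ht
  have hfb : ∀ k t, |f k t| ≤ c k * D := fun k t => by
    simp only [hf]
    rw [abs_mul, abs_of_pos (hc0 k)]
    exact mul_le_mul_of_nonneg_left (hD _) (hc0 k).le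
  have hf1 : ∀ k, ∫ t, f k t = 1 := fun k => integral_rightKernel (hc0 k)
  have hfi : ∀ k, Integrable (f k) := fun k => (hfc k).integrable_of_hasCompactSupport (hfs k)
  set f' : ℕ → ℝ → ℝ := fun k t =>
    c k * (deriv (deriv Real.smoothTransition) (c k * t) * c k) with hf'
  have hfd : ∀ k t, HasDerivAt (f k) (f' k t) t := by
    intro k t
    have hl : HasDerivAt (fun t => c k * t) (c k) t := by
      simpa using (hasDerivAt_id t).const_mul (c k)
    exact ((hK1d (c k * t)).comp t hl).const_mul (c k)
  have hf'c : ∀ k, Continuous (f' k) := fun k =>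
    continuous_const.mul ((hK2c.comp (continuous_const.mul continuous_id)).mul continuous_const)
  have hf'z : ∀ k t, t ∉ Icc (0 : ℝ) (1 / c k) → f' k t = 0 := by
    intro k t ht
    have h' : c k * t < 0 ∨ 1 < c k * t := by
      rcases lt_or_ge t 0 with h1 | h1
      · exact Or.inl (mul_neg_of_pos_of_neg (hc0 k) h1)
      · right
        have h2 : 1 / c k < t := by
          by_contra h3
          exact ht ⟨h1, not_lt.1 h3⟩
        rw [div_lt_iff₀' (hc0 k)] at h2
        exact h2
    simp only [hf', deriv_deriv_smoothTransition_eq_zero h', zero_mul, mul_zero]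
  have hf's : ∀ k, HasCompactSupport (f' k) := fun k =>
    HasCompactSupport.intro isCompact_Icc (hf'z k)
  have hf'b : ∀ k t, |f' k t| ≤ c k * c k * D₂ := fun k t => by
    simp only [hf']
    rw [abs_mul, abs_mul, abs_of_pos (hc0 k)]
    have := hD₂ (c k * t)
    rw [Real.norm_eq_abs] at this
    nlinarith [abs_nonneg (deriv (deriv Real.smoothTransition) (c k * t)), hc0 k]
  have hf'i : ∀ k, Integrable (f' k) := fun k => (hf'c k).integrable_of_hasCompactSupport (hf's k)
  have hf'0 : ∀ k, ∫ t, f' k t = 0 := fun k =>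
    integral_eq_zero_of_hasDerivAt_of_integrable (hfd k) (hf'i k) (hfi k)
  have hti : ∀ k, Integrable fun t => t * f' k t := fun k =>
    (continuous_id.mul (hf'c k)).integrable_of_hasCompactSupport (hf's k).mul_left
  have hf'1 : ∀ k, ∫ t, t * f' k t = -1 := by
    intro k
    have := integral_mul_deriv_eq_deriv_mul_of_integrable (u := fun t : ℝ => t)
      (u' := fun _ => (1 : ℝ)) (v := f k) (v' := f' k)
      (fun t _ => hasDerivAt_id t) (fun t _ => hfd k t) (hti k)
      (show Integrable ((fun _ => (1 : ℝ)) * f k) from by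
        have e : ((fun _ => (1 : ℝ)) * f k) = f k := by funext t; simp
        rw [e]; exact hfi k)
      ((continuous_id.mul (hfc k)).integrable_of_hasCompactSupport (hfs k).mul_left)
    rw [this]
    simp [hf1 k]
  -- the approximants `g k = f k ⋆ h`
  set g : ℕ → ℝ → ℝ := fun k x => ∫ t, f k t * h (x - t) with hg
  have hgconv : ∀ k, g k = (f k ⋆[ContinuousLinearMap.lsmul ℝ ℝ, volume] h) := by
    intro k
    funext x
    exact (MeasureTheory.convolution_lsmul (f := f k) (g := h) (x := x) (μ := volume)).symm
  have hgs : ∀ k, ContDiff ℝ (⊤ : ℕ∞) (g k) := by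
    intro k
    rw [hgconv k]
    exact (hfs k).contDiff_convolution_left (ContinuousLinearMap.lsmul ℝ ℝ) (hfK k) hhli
  have hsl : ∀ k x, Integrable fun t => f k t * h (x - t) := fun k x =>
    ((hfc k).mul (hhc.comp (continuous_const.sub continuous_id))).integrable_of_hasCompactSupport
      (hfs k).mul_right
  -- Lipschitz with the same constant
  have hgl : ∀ k, LipschitzWith K (g k) := by
    intro k
    refine LipschitzWith.of_dist_le_mul fun x y => ?_
    rw [Real.dist_eq, Real.dist_eq]
    have e : g k x - g k y = ∫ t, f k t * (h (x - t) - h (y - t)) := by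
      simp only [hg]
      rw [← integral_sub (hsl k x) (hsl k y)]
      congr 1
      funext t
      ring
    rw [e]
    have hbound : ∀ t, ‖f k t * (h (x - t) - h (y - t))‖ ≤ f k t * (K * |x - y|) := by
      intro t
      rw [norm_mul, Real.norm_eq_abs, abs_of_nonneg (hf0 k t), Real.norm_eq_abs]
      refine mul_le_mul_of_nonneg_left ?_ (hf0 k t)
      have := hh.dist_le_mul (x - t) (y - t)
      rwa [Real.dist_eq, Real.dist_eq, show x - t - (y - t) = x - y by ring] at this
    calc |∫ t, f k t * (h (x - t) - h (y - t))| = ‖∫ t, f k t * (h (x - t) - h (y - t))‖ :=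
          (Real.norm_eq_abs _).symm
      _ ≤ ∫ t, f k t * (K * |x - y|) :=
          norm_integral_le_of_norm_le ((hfi k).mul_const _) (ae_of_all _ hbound)
      _ = K * |x - y| := by rw [integral_mul_const, hf1 k, one_mul]
  -- uniformly close to `h`
  have hga : ∀ k x, |g k x - h x| ≤ D * K / c k := by
    intro k x
    have e : g k x - h x = ∫ t, f k t * (h (x - t) - h x) := by
      simp only [hg]
      rw [show (fun t => f k t * (h (x - t) - h x)) = fun t => f k t * h (x - t) - f k t * h x by
        funext t; ring, integral_sub (hsl k x) ((hfi k).mul_const _), integral_mul_const, hf1 k,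
        one_mul]
    rw [e]
    have hgI : Integrable ((Ioo (0 : ℝ) (1 / c k)).indicator fun _ => c k * D * (K * (1 / c k))) :=
      ((continuous_const.integrableOn_Icc (a := (0 : ℝ)) (b := 1 / c k)).mono_set
        Ioo_subset_Icc_self).integrable_indicator measurableSet_Ioo
    refine ((Real.norm_eq_abs _).symm.le.trans
      (norm_integral_le_of_norm_le hgI (ae_of_all _ fun t => ?_))).trans ?_
    · by_cases ht : t ∈ Ioo (0 : ℝ) (1 / c k)
      · rw [indicator_of_mem ht, norm_mul, Real.norm_eq_abs, Real.norm_eq_abs]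
        refine mul_le_mul (hfb k t) ?_ (abs_nonneg _) (by positivity)
        have := hh.dist_le_mul (x - t) x
        rw [Real.dist_eq, Real.dist_eq, show x - t - x = -t by ring, abs_neg, abs_of_pos ht.1] at this
        exact this.trans (mul_le_mul_of_nonneg_left ht.2.le hK0)
      · rw [indicator_of_notMem ht, hfz k t ht, zero_mul, norm_zero]
    · rw [integral_indicator_const _ measurableSet_Ioo, Real.volume_real_Ioo_of_le (by positivity),
        sub_zero, smul_eq_mul]
      have hck := (hc0 k).ne'
      exact le_of_eq (by field_simp)
  -- the derivative of `g k`
  have hgd : ∀ k x, HasDerivAt (g k) (∫ t, f' k t * h (x - t)) x := by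
    intro k x
    have h1 := (hfs k).hasDerivAt_convolution_left (ContinuousLinearMap.lsmul ℝ ℝ)
      ((hfK k).of_le (by exact_mod_cast le_top) : ContDiff ℝ 1 (f k)) hhli x
    have hderiv : deriv (f k) = f' k := funext fun t => (hfd k t).deriv
    rw [← hgconv k, hderiv, MeasureTheory.convolution_lsmul] at h1
    exact h1
  refine ⟨g, hgs, hgl, ⟨D * K, fun k x => hga k x⟩, fun x hx => ?_⟩
  -- convergence of derivatives at a point of differentiability of `h`
  set ch := deriv h x with hch
  have hxd : HasDerivAt h ch x := hx.hasDerivAt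
  rw [Metric.tendsto_atTop]
  intro ε hε
  set δ : ℝ := ε / (2 * (D₂ + 1)) with hδ
  have hδ0 : 0 < δ := by positivity
  have hlo := (hasDerivAt_iff_isLittleO.1 hxd).bound hδ0
  obtain ⟨ρ, hρ, hρ'⟩ := Metric.eventually_nhds_iff.1 hlo
  obtain ⟨N, hN⟩ := exists_nat_gt (1 / ρ)
  refine ⟨N, fun k hk => ?_⟩
  have hck : 1 / c k < ρ := by
    have h1 : 1 / ρ < c k := hN.trans_le (by
      simp only [hc]
      have : (N : ℝ) ≤ k := by exact_mod_cast hk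
      linarith)
    rw [div_lt_iff₀ (hc0 k)]
    rw [div_lt_iff₀ hρ] at h1
    linarith
  rw [(hgd k x).deriv, Real.dist_eq]
  have hrsl : Integrable fun t => f' k t * h (x - t) :=
    ((hf'c k).mul (hhc.comp (continuous_const.sub continuous_id))).integrable_of_hasCompactSupport
      (hf's k).mul_right
  have e : (∫ t, f' k t * h (x - t)) - ch = ∫ t, f' k t * (h (x - t) - h x + t * ch) := by
    have e1 : (fun t => f' k t * (h (x - t) - h x + t * ch))
        = fun t => (f' k t * h (x - t) - f' k t * h x) + t * f' k t * ch := by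
      funext t; ring
    have i1 : Integrable (fun t => f' k t * h (x - t) - f' k t * h x) :=
      hrsl.sub ((hf'i k).mul_const _)
    have i2 : Integrable (fun t => t * f' k t * ch) := (hti k).mul_const ch
    rw [e1, integral_add i1 i2, integral_sub hrsl ((hf'i k).mul_const _), integral_mul_const,
      integral_mul_const, hf'0 k, hf'1 k]
    ring
  rw [e]
  have hgI : Integrable ((Icc (0 : ℝ) (1 / c k)).indicator fun _ =>
      c k * c k * D₂ * (δ * (1 / c k))) :=
    (continuous_const.integrableOn_Icc (a := (0 : ℝ)) (b := 1 / c k)).integrable_indicator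
      measurableSet_Icc
  have hpt : ∀ t, ‖f' k t * (h (x - t) - h x + t * ch)‖
      ≤ (Icc (0 : ℝ) (1 / c k)).indicator (fun _ => c k * c k * D₂ * (δ * (1 / c k))) t := by
    intro t
    by_cases ht : t ∈ Icc (0 : ℝ) (1 / c k)
    · rw [indicator_of_mem ht, norm_mul, Real.norm_eq_abs, Real.norm_eq_abs]
      refine mul_le_mul (hf'b k t) ?_ (abs_nonneg _) (by positivity)
      have hdist : dist (x - t) x < ρ := by
        rw [Real.dist_eq, show x - t - x = -t by ring, abs_neg, abs_of_nonneg ht.1]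
        exact ht.2.trans_lt hck
      have := hρ' hdist
      rw [show x - t - x = -t by ring, smul_eq_mul, Real.norm_eq_abs, Real.norm_eq_abs, abs_neg,
        abs_of_nonneg ht.1] at this
      rw [show h (x - t) - h x + t * ch = h (x - t) - h x - -t * ch by ring]
      exact this.trans (mul_le_mul_of_nonneg_left ht.2 hδ0.le)
    · rw [indicator_of_notMem ht, hf'z k t ht, zero_mul, norm_zero]
  have hck' := (hc0 k).ne'
  calc |∫ t, f' k t * (h (x - t) - h x + t * ch)|
      ≤ ∫ t, (Icc (0 : ℝ) (1 / c k)).indicator (fun _ => c k * c k * D₂ * (δ * (1 / c k))) t :=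
        (Real.norm_eq_abs _).symm.le.trans (norm_integral_le_of_norm_le hgI (ae_of_all _ hpt))
    _ = D₂ * δ := by
        rw [integral_indicator_const _ measurableSet_Icc, Real.volume_real_Icc_of_le (by positivity),
          sub_zero, smul_eq_mul]
        field_simp
    _ < ε := by
        have hD1' : (D₂ + 1) ≠ 0 := by positivity
        have heq : (D₂ + 1) * δ = ε / 2 := by
          rw [hδ, mul_div_assoc', mul_comm (2 : ℝ) (D₂ + 1), mul_div_mul_left _ _ hD1']
        calc D₂ * δ ≤ (D₂ + 1) * δ := mul_le_mul_of_nonneg_right (by linarith) hδ0.le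
          _ = ε / 2 := heq
          _ < ε := half_lt_self hε

end LipschitzMollification

/-! ## Traces along approximating fronts -/

section TraceTransfer

/-- **Traces along curves approaching a curve from the right converge to the right trace.** If
`ua` is a right strong trace of `u` along `a` and `uaj` are right strong traces along curves
`a ≤ a_j ≤ a + d_j`, `d_j → 0⁺` (Def. 1.2 on `(0,T)`), then `uaj → ua` in `L¹(0,T)`.
[folklore] -/
theorem tendsto_lintegral_enorm_trace_sub_of_approx_right {u : ℝ → ℝ → Fin n → ℝ}
    (hum : Measurable (Function.uncurry u)) {a : ℝ → ℝ} {aj : ℕ → ℝ → ℝ}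
    (hajm : ∀ j, Measurable (aj j)) {ua : ℝ → Fin n → ℝ} {uaj : ℕ → ℝ → Fin n → ℝ}
    (huajm : ∀ j, Measurable (uaj j)) {d : ℕ → ℝ} (hd0 : ∀ j, 0 < d j)
    (hd : Tendsto d atTop (𝓝 0)) (hclose : ∀ j t, a t ≤ aj j t ∧ aj j t ≤ a t + d j) {T : ℝ}
    (hua : Tendsto (fun k : ℕ => ∫⁻ t in Ioo 0 T, essSup (fun y => ‖u t (a t + y) - ua t‖ₑ)
      (volume.restrict (Ioo 0 (1 / (k : ℝ))))) atTop (𝓝 0))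
    (huaj : ∀ j, Tendsto (fun k : ℕ => ∫⁻ t in Ioo 0 T,
      essSup (fun y => ‖u t (aj j t + y) - uaj j t‖ₑ) (volume.restrict (Ioo 0 (1 / (k : ℝ)))))
      atTop (𝓝 0)) :
    Tendsto (fun j => ∫⁻ t in Ioo 0 T, ‖uaj j t - ua t‖ₑ) atTop (𝓝 0) := by
  set B : ℝ → ℝ≥0∞ := fun δ => ∫⁻ t in Ioo 0 T,
    essSup (fun y => ‖u t (a t + y) - ua t‖ₑ) (volume.restrict (Ioo 0 δ)) with hB
  have hBmono : ∀ δ δ', δ ≤ δ' → B δ ≤ B δ' := fun δ δ' h =>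
    lintegral_mono fun t => essSup_mono_measure'
      (Measure.restrict_mono (Ioo_subset_Ioo_right h) le_rfl)
  -- key estimate
  have hkey : ∀ j (m : ℕ), 1 ≤ m → ∫⁻ t in Ioo 0 T, ‖uaj j t - ua t‖ₑ
      ≤ (∫⁻ t in Ioo 0 T, essSup (fun y => ‖u t (aj j t + y) - uaj j t‖ₑ)
          (volume.restrict (Ioo 0 (1 / (m : ℝ))))) + B (d j + 1 / (m : ℝ)) := by
    intro j m hm
    have hmpos : (0 : ℝ) < 1 / (m : ℝ) := by
      have : (0 : ℝ) < m := by exact_mod_cast hm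
      positivity
    have hG : Measurable fun p : ℝ × ℝ => ‖u p.1 (aj j p.1 + p.2) - uaj j p.1‖ₑ :=
      ((hum.comp (measurable_fst.prodMk (((hajm j).comp measurable_fst).add measurable_snd))).sub
        ((huajm j).comp measurable_fst)).enorm
    have hmeas : Measurable fun t => essSup (fun y => ‖u t (aj j t + y) - uaj j t‖ₑ)
        (volume.restrict (Ioo 0 (1 / (m : ℝ)))) := measurable_essSup_prod hG _
    simp only [hB]
    rw [← lintegral_add_left hmeas]
    refine lintegral_mono fun t => ?_
    set s := aj j t - a t with hs
    have hs0 : 0 ≤ s := by have := (hclose j t).1; linarith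
    have hsd : s ≤ d j := by have := (hclose j t).2; linarith
    have h1 : ∀ᵐ y ∂(volume.restrict (Ioo 0 (1 / (m : ℝ)))), ‖u t (aj j t + y) - uaj j t‖ₑ
        ≤ essSup (fun y => ‖u t (aj j t + y) - uaj j t‖ₑ) (volume.restrict (Ioo 0 (1 / (m : ℝ)))) :=
      ENNReal.ae_le_essSup _
    have h2' : ∀ᵐ y' ∂(volume.restrict (Ioo 0 (d j + 1 / (m : ℝ)))), ‖u t (a t + y') - ua t‖ₑ
        ≤ essSup (fun y => ‖u t (a t + y) - ua t‖ₑ) (volume.restrict (Ioo 0 (d j + 1 / (m : ℝ)))) :=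
      ENNReal.ae_le_essSup _
    have h2 : ∀ᵐ y ∂(volume.restrict (Ioo 0 (1 / (m : ℝ)))), ‖u t (a t + (y + s)) - ua t‖ₑ
        ≤ essSup (fun y => ‖u t (a t + y) - ua t‖ₑ) (volume.restrict (Ioo 0 (d j + 1 / (m : ℝ)))) := by
      rw [ae_restrict_iff' measurableSet_Ioo] at h2' ⊢
      have hmp : MeasurePreserving (fun y : ℝ => y + s) volume volume :=
        measurePreserving_add_right volume s
      filter_upwards [hmp.quasiMeasurePreserving.ae h2'] with y hy hyI
      exact hy ⟨by linarith [hyI.1], by linarith [hyI.2]⟩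
    have hne : NeBot (ae (volume.restrict (Ioo (0 : ℝ) (1 / (m : ℝ))))) := by
      rw [ae_neBot, Ne, Measure.restrict_eq_zero, Real.volume_Ioo, sub_zero, ENNReal.ofReal_eq_zero,
        not_le]
      exact hmpos
    obtain ⟨y, hy1, hy2⟩ := (h1.and h2).exists
    have e : aj j t + y = a t + (y + s) := by rw [hs]; ring
    calc ‖uaj j t - ua t‖ₑ = edist (uaj j t) (ua t) := (edist_eq_enorm_sub _ _).symm
      _ ≤ edist (uaj j t) (u t (aj j t + y)) + edist (u t (aj j t + y)) (ua t) := edist_triangle _ _ _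
      _ = ‖u t (aj j t + y) - uaj j t‖ₑ + ‖u t (a t + (y + s)) - ua t‖ₑ := by
          rw [edist_comm, edist_eq_enorm_sub, edist_eq_enorm_sub, e]
      _ ≤ _ := add_le_add hy1 hy2
  -- hence `∫ ‖uaj j - ua‖ ≤ B (2 d_j)`
  have hle : ∀ j, ∫⁻ t in Ioo 0 T, ‖uaj j t - ua t‖ₑ ≤ B (2 * d j) := by
    intro j
    have hlim : Tendsto (fun m : ℕ => (∫⁻ t in Ioo 0 T,
        essSup (fun y => ‖u t (aj j t + y) - uaj j t‖ₑ) (volume.restrict (Ioo 0 (1 / (m : ℝ)))))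
        + B (2 * d j)) atTop (𝓝 (B (2 * d j))) := by
      have := (huaj j).add (tendsto_const_nhds (x := B (2 * d j)))
      rwa [zero_add] at this
    refine ge_of_tendsto hlim ?_
    obtain ⟨m₀, hm₀⟩ := exists_nat_gt (1 / d j)
    filter_upwards [eventually_ge_atTop (max m₀ 1)] with m hm
    have hm1 : 1 ≤ m := (le_max_right _ _).trans hm
    have hmpos : (0 : ℝ) < m := by exact_mod_cast hm1
    have hdm : 1 / (m : ℝ) ≤ d j := by
      have h1 : 1 / d j < m := hm₀.trans_le (by exact_mod_cast (le_max_left _ _).trans hm)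
      rw [div_lt_iff₀ (hd0 j)] at h1
      rw [div_le_iff₀ hmpos]
      linarith
    exact (hkey j m hm1).trans (add_le_add le_rfl (hBmono _ _ (by linarith)))
  -- and `B (2 d_j) → 0`
  rw [ENNReal.tendsto_atTop_zero]
  intro ε hε
  obtain ⟨k₀, hk₀⟩ := ENNReal.tendsto_atTop_zero.1 hua ε hε
  have hk₁ := hk₀ (max k₀ 1) (le_max_left _ _)
  have hpos : (0 : ℝ) < 1 / ((max k₀ 1 : ℕ) : ℝ) := by
    have : (0 : ℝ) < ((max k₀ 1 : ℕ) : ℝ) := by exact_mod_cast (le_max_right k₀ 1).trans_lt' zero_lt_one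
    positivity
  have hev : ∀ᶠ j in atTop, 2 * d j ≤ 1 / ((max k₀ 1 : ℕ) : ℝ) := by
    have : Tendsto (fun j => 2 * d j) atTop (𝓝 0) := by simpa using hd.const_mul 2
    exact this.eventually (eventually_le_nhds hpos)
  obtain ⟨J, hJ⟩ := eventually_atTop.1 hev
  exact ⟨J, fun j hj => (hle j).trans ((hBmono _ _ (hJ j hj)).trans hk₁)⟩

/-- **Traces along curves approaching a curve from the left converge to the left trace.** If
`ub` is a left strong trace of `u` along `b` and `ubj` are left strong traces along curves
`b - d_j ≤ b_j ≤ b`, `d_j → 0⁺` (Def. 1.2 on `(0,T)`), then `ubj → ub` in `L¹(0,T)`.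
[folklore] -/
theorem tendsto_lintegral_enorm_trace_sub_of_approx_left {u : ℝ → ℝ → Fin n → ℝ}
    (hum : Measurable (Function.uncurry u)) {b : ℝ → ℝ} {bj : ℕ → ℝ → ℝ}
    (hbjm : ∀ j, Measurable (bj j)) {ub : ℝ → Fin n → ℝ} {ubj : ℕ → ℝ → Fin n → ℝ}
    (hubjm : ∀ j, Measurable (ubj j)) {d : ℕ → ℝ} (hd0 : ∀ j, 0 < d j)
    (hd : Tendsto d atTop (𝓝 0)) (hclose : ∀ j t, b t - d j ≤ bj j t ∧ bj j t ≤ b t) {T : ℝ}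
    (hub : Tendsto (fun k : ℕ => ∫⁻ t in Ioo 0 T, essSup (fun y => ‖u t (b t + y) - ub t‖ₑ)
      (volume.restrict (Ioo (-(1 / (k : ℝ))) 0))) atTop (𝓝 0))
    (hubj : ∀ j, Tendsto (fun k : ℕ => ∫⁻ t in Ioo 0 T,
      essSup (fun y => ‖u t (bj j t + y) - ubj j t‖ₑ) (volume.restrict (Ioo (-(1 / (k : ℝ))) 0)))
      atTop (𝓝 0)) :
    Tendsto (fun j => ∫⁻ t in Ioo 0 T, ‖ubj j t - ub t‖ₑ) atTop (𝓝 0) := by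
  set B : ℝ → ℝ≥0∞ := fun δ => ∫⁻ t in Ioo 0 T,
    essSup (fun y => ‖u t (b t + y) - ub t‖ₑ) (volume.restrict (Ioo (-δ) 0)) with hB
  have hBmono : ∀ δ δ', δ ≤ δ' → B δ ≤ B δ' := fun δ δ' h =>
    lintegral_mono fun t => essSup_mono_measure'
      (Measure.restrict_mono (Ioo_subset_Ioo_left (neg_le_neg h)) le_rfl)
  have hkey : ∀ j (m : ℕ), 1 ≤ m → ∫⁻ t in Ioo 0 T, ‖ubj j t - ub t‖ₑ
      ≤ (∫⁻ t in Ioo 0 T, essSup (fun y => ‖u t (bj j t + y) - ubj j t‖ₑ)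
          (volume.restrict (Ioo (-(1 / (m : ℝ))) 0))) + B (d j + 1 / (m : ℝ)) := by
    intro j m hm
    have hmpos : (0 : ℝ) < 1 / (m : ℝ) := by
      have : (0 : ℝ) < m := by exact_mod_cast hm
      positivity
    have hG : Measurable fun p : ℝ × ℝ => ‖u p.1 (bj j p.1 + p.2) - ubj j p.1‖ₑ :=
      ((hum.comp (measurable_fst.prodMk (((hbjm j).comp measurable_fst).add measurable_snd))).sub
        ((hubjm j).comp measurable_fst)).enorm
    have hmeas : Measurable fun t => essSup (fun y => ‖u t (bj j t + y) - ubj j t‖ₑ)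
        (volume.restrict (Ioo (-(1 / (m : ℝ))) 0)) := measurable_essSup_prod hG _
    simp only [hB]
    rw [← lintegral_add_left hmeas]
    refine lintegral_mono fun t => ?_
    set s := bj j t - b t with hs
    have hs0 : s ≤ 0 := by have := (hclose j t).2; linarith
    have hsd : -d j ≤ s := by have := (hclose j t).1; linarith
    have h1 : ∀ᵐ y ∂(volume.restrict (Ioo (-(1 / (m : ℝ))) 0)), ‖u t (bj j t + y) - ubj j t‖ₑ
        ≤ essSup (fun y => ‖u t (bj j t + y) - ubj j t‖ₑ)
          (volume.restrict (Ioo (-(1 / (m : ℝ))) 0)) :=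
      ENNReal.ae_le_essSup _
    have h2' : ∀ᵐ y' ∂(volume.restrict (Ioo (-(d j + 1 / (m : ℝ))) 0)), ‖u t (b t + y') - ub t‖ₑ
        ≤ essSup (fun y => ‖u t (b t + y) - ub t‖ₑ)
          (volume.restrict (Ioo (-(d j + 1 / (m : ℝ))) 0)) :=
      ENNReal.ae_le_essSup _
    have h2 : ∀ᵐ y ∂(volume.restrict (Ioo (-(1 / (m : ℝ))) 0)), ‖u t (b t + (y + s)) - ub t‖ₑ
        ≤ essSup (fun y => ‖u t (b t + y) - ub t‖ₑ)
          (volume.restrict (Ioo (-(d j + 1 / (m : ℝ))) 0)) := by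
      rw [ae_restrict_iff' measurableSet_Ioo] at h2' ⊢
      have hmp : MeasurePreserving (fun y : ℝ => y + s) volume volume :=
        measurePreserving_add_right volume s
      filter_upwards [hmp.quasiMeasurePreserving.ae h2'] with y hy hyI
      exact hy ⟨by linarith [hyI.1], by linarith [hyI.2]⟩
    have hne : NeBot (ae (volume.restrict (Ioo (-(1 / (m : ℝ))) (0 : ℝ)))) := by
      rw [ae_neBot, Ne, Measure.restrict_eq_zero, Real.volume_Ioo, sub_neg_eq_add, zero_add,
        ENNReal.ofReal_eq_zero, not_le]
      exact hmpos
    obtain ⟨y, hy1, hy2⟩ := (h1.and h2).exists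
    have e : bj j t + y = b t + (y + s) := by rw [hs]; ring
    calc ‖ubj j t - ub t‖ₑ = edist (ubj j t) (ub t) := (edist_eq_enorm_sub _ _).symm
      _ ≤ edist (ubj j t) (u t (bj j t + y)) + edist (u t (bj j t + y)) (ub t) := edist_triangle _ _ _
      _ = ‖u t (bj j t + y) - ubj j t‖ₑ + ‖u t (b t + (y + s)) - ub t‖ₑ := by
          rw [edist_comm, edist_eq_enorm_sub, edist_eq_enorm_sub, e]
      _ ≤ _ := add_le_add hy1 hy2
  have hle : ∀ j, ∫⁻ t in Ioo 0 T, ‖ubj j t - ub t‖ₑ ≤ B (2 * d j) := by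
    intro j
    have hlim : Tendsto (fun m : ℕ => (∫⁻ t in Ioo 0 T,
        essSup (fun y => ‖u t (bj j t + y) - ubj j t‖ₑ) (volume.restrict (Ioo (-(1 / (m : ℝ))) 0)))
        + B (2 * d j)) atTop (𝓝 (B (2 * d j))) := by
      have := (hubj j).add (tendsto_const_nhds (x := B (2 * d j)))
      rwa [zero_add] at this
    refine ge_of_tendsto hlim ?_
    obtain ⟨m₀, hm₀⟩ := exists_nat_gt (1 / d j)
    filter_upwards [eventually_ge_atTop (max m₀ 1)] with m hm
    have hm1 : 1 ≤ m := (le_max_right _ _).trans hm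
    have hmpos : (0 : ℝ) < m := by exact_mod_cast hm1
    have hdm : 1 / (m : ℝ) ≤ d j := by
      have h1 : 1 / d j < m := hm₀.trans_le (by exact_mod_cast (le_max_left _ _).trans hm)
      rw [div_lt_iff₀ (hd0 j)] at h1
      rw [div_le_iff₀ hmpos]
      linarith
    exact (hkey j m hm1).trans (add_le_add le_rfl (hBmono _ _ (by linarith)))
  rw [ENNReal.tendsto_atTop_zero]
  intro ε hε
  obtain ⟨k₀, hk₀⟩ := ENNReal.tendsto_atTop_zero.1 hub ε hε
  have hk₁ := hk₀ (max k₀ 1) (le_max_left _ _)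
  have hpos : (0 : ℝ) < 1 / ((max k₀ 1 : ℕ) : ℝ) := by
    have : (0 : ℝ) < ((max k₀ 1 : ℕ) : ℝ) := by exact_mod_cast (le_max_right k₀ 1).trans_lt' zero_lt_one
    positivity
  have hev : ∀ᶠ j in atTop, 2 * d j ≤ 1 / ((max k₀ 1 : ℕ) : ℝ) := by
    have : Tendsto (fun j => 2 * d j) atTop (𝓝 0) := by simpa using hd.const_mul 2
    exact this.eventually (eventually_le_nhds hpos)
  obtain ⟨J, hJ⟩ := eventually_atTop.1 hev
  exact ⟨J, fun j hj => (hle j).trans ((hBmono _ _ (hJ j hj)).trans hk₁)⟩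

end TraceTransfer

/-! ## The cell inequality with Lipschitz fronts -/

section LipschitzFronts

open scoped NNReal

/-- `L¹`-convergence passes to bounded uniformly continuous observables: if `v_j → v` in
`L¹(s)` (`s` of finite measure), all valued in `W`, and `E` is bounded and uniformly continuous
on `W`, then `E ∘ v_j → E ∘ v` in `L¹(s)`. [folklore] -/
theorem tendsto_lintegral_enorm_comp_sub_of_uniformContinuousOn {v : ℝ → Fin n → ℝ}
    {vj : ℕ → ℝ → Fin n → ℝ} {W : Set (Fin n → ℝ)} {E : (Fin n → ℝ) → ℝ}
    (hE : UniformContinuousOn E W) {B : ℝ} (hB : ∀ p ∈ W, |E p| ≤ B) (hvW : ∀ t, v t ∈ W)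
    (hvjW : ∀ j t, vj j t ∈ W) {s : Set ℝ} (hs : volume s ≠ ⊤)
    (h : Tendsto (fun j => ∫⁻ t in s, ‖vj j t - v t‖ₑ) atTop (𝓝 0)) :
    Tendsto (fun j => ∫⁻ t in s, ‖E (vj j t) - E (v t)‖ₑ) atTop (𝓝 0) := by
  rw [ENNReal.tendsto_atTop_zero]
  intro ε hε
  -- a real `e > 0` with `e |s| ≤ ε / 2`
  obtain ⟨e, he, hes⟩ : ∃ e : ℝ, 0 < e ∧ ENNReal.ofReal e * volume s ≤ ε / 2 := by
    rcases eq_or_ne ε ⊤ with rfl | hεtop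
    · refine ⟨1, one_pos, ?_⟩
      rw [ENNReal.top_div_of_ne_top (by norm_num)]
      exact le_top
    rcases eq_or_ne (volume s) 0 with hs0 | hs0
    · exact ⟨1, one_pos, by rw [hs0, mul_zero]; exact zero_le⟩
    have hsr : 0 < (volume s).toReal := ENNReal.toReal_pos hs0 hs
    have hε2 : 0 < (ε / 2).toReal :=
      ENNReal.toReal_pos (ENNReal.half_pos hε.ne').ne' (ENNReal.div_ne_top hεtop (by norm_num))
    refine ⟨(ε / 2).toReal / (volume s).toReal, div_pos hε2 hsr, le_of_eq ?_⟩
    have hV : ENNReal.ofReal (volume s).toReal = volume s := ENNReal.ofReal_toReal hs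
    calc ENNReal.ofReal ((ε / 2).toReal / (volume s).toReal) * volume s
        = ENNReal.ofReal ((ε / 2).toReal / (volume s).toReal)
            * ENNReal.ofReal (volume s).toReal := by rw [hV]
      _ = ENNReal.ofReal ((ε / 2).toReal / (volume s).toReal * (volume s).toReal) :=
          (ENNReal.ofReal_mul (by positivity)).symm
      _ = ε / 2 := by
          rw [div_mul_cancel₀ _ hsr.ne', ENNReal.ofReal_toReal (ENNReal.div_ne_top hεtop (by norm_num))]
  -- modulus of continuity
  obtain ⟨δ, hδ, hδE⟩ := Metric.uniformContinuousOn_iff.1 hE e he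
  have hB0 : 0 ≤ B := (abs_nonneg _).trans (hB _ (hvW 0))
  set L : ℝ := 2 * B / δ with hL
  have hL0 : 0 ≤ L := by positivity
  have hmod : ∀ p ∈ W, ∀ p' ∈ W, |E p - E p'| ≤ e + L * ‖p - p'‖ := by
    intro p hp p' hp'
    rcases lt_or_ge ‖p - p'‖ δ with hpq | hpq
    · have h1 : dist (E p) (E p') < e := hδE p hp p' hp' (by rwa [dist_eq_norm])
      rw [Real.dist_eq] at h1
      have h2 : 0 ≤ L * ‖p - p'‖ := by positivity
      linarith
    · have h1 : |E p - E p'| ≤ 2 * B := by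
        calc |E p - E p'| ≤ |E p| + |E p'| := abs_sub _ _
          _ ≤ B + B := add_le_add (hB p hp) (hB p' hp')
          _ = 2 * B := by ring
      have h2 : 2 * B = L * δ := by rw [hL]; field_simp
      have h3 : L * δ ≤ L * ‖p - p'‖ := mul_le_mul_of_nonneg_left hpq hL0
      linarith
  have hpt : ∀ j t, ‖E (vj j t) - E (v t)‖ₑ
      ≤ ENNReal.ofReal e + ENNReal.ofReal L * ‖vj j t - v t‖ₑ := by
    intro j t
    rw [← ofReal_norm, ← ofReal_norm, ← ENNReal.ofReal_mul hL0,
      ← ENNReal.ofReal_add he.le (by positivity), Real.norm_eq_abs]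
    exact ENNReal.ofReal_le_ofReal (hmod _ (hvjW j t) _ (hvW t))
  have hint : ∀ j, ∫⁻ t in s, ‖E (vj j t) - E (v t)‖ₑ
      ≤ ε / 2 + ENNReal.ofReal L * ∫⁻ t in s, ‖vj j t - v t‖ₑ := by
    intro j
    calc ∫⁻ t in s, ‖E (vj j t) - E (v t)‖ₑ
        ≤ ∫⁻ t in s, (ENNReal.ofReal e + ENNReal.ofReal L * ‖vj j t - v t‖ₑ) :=
          lintegral_mono fun t => hpt j t
      _ = ENNReal.ofReal e * volume s + ENNReal.ofReal L * ∫⁻ t in s, ‖vj j t - v t‖ₑ := by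
          rw [lintegral_add_left measurable_const, lintegral_const, Measure.restrict_apply_univ,
            lintegral_const_mul' _ _ ENNReal.ofReal_ne_top]
      _ ≤ ε / 2 + ENNReal.ofReal L * ∫⁻ t in s, ‖vj j t - v t‖ₑ := by gcongr
  have hlim : Tendsto (fun j => ENNReal.ofReal L * ∫⁻ t in s, ‖vj j t - v t‖ₑ) atTop (𝓝 0) := by
    have := ENNReal.Tendsto.const_mul h (Or.inr ENNReal.ofReal_ne_top) (a := ENNReal.ofReal L)
    rwa [mul_zero] at this
  obtain ⟨N, hN⟩ := ENNReal.tendsto_atTop_zero.1 hlim (ε / 2) (ENNReal.half_pos hε.ne')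
  refine ⟨N, fun j hj => ?_⟩
  calc ∫⁻ t in s, ‖E (vj j t) - E (v t)‖ₑ ≤ ε / 2 + ENNReal.ofReal L * ∫⁻ t in s, ‖vj j t - v t‖ₑ :=
        hint j
    _ ≤ ε / 2 + ε / 2 := by gcongr; exact hN j hj
    _ = ε := ENNReal.add_halves ε

end LipschitzFronts

section LipschitzFrontsMain

open scoped NNReal

/-- Uniform continuity of the relative entropy observable `p ↦ η(p) - η(c) - π·(p - c)` on a set
where `η` is uniformly continuous. [folklore] -/
theorem uniformContinuousOn_relEntropyObs {η : (Fin n → ℝ) → ℝ} {W : Set (Fin n → ℝ)}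
    (hηc : UniformContinuousOn η W) (c π : Fin n → ℝ) :
    UniformContinuousOn (fun p => η p - η c - π ⬝ᵥ (p - c)) W := by
  set Λ : ℝ := ∑ i, |π i| with hΛ
  have hΛ0 : 0 ≤ Λ := Finset.sum_nonneg fun i _ => abs_nonneg _
  rw [Metric.uniformContinuousOn_iff]
  intro ε hε
  obtain ⟨δ₁, hδ₁, h₁⟩ := Metric.uniformContinuousOn_iff.1 hηc (ε / 2) (half_pos hε)
  refine ⟨min δ₁ (ε / 2 / (Λ + 1)), lt_min hδ₁ (by positivity), fun p hp p' hp' hpp' => ?_⟩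
  have hd1 : dist p p' < δ₁ := hpp'.trans_le (min_le_left _ _)
  have hd2 : dist p p' < ε / 2 / (Λ + 1) := hpp'.trans_le (min_le_right _ _)
  have hη' : dist (η p) (η p') < ε / 2 := h₁ p hp p' hp' hd1
  rw [Real.dist_eq] at hη' ⊢
  rw [dist_eq_norm] at hd2
  have hlin : |π ⬝ᵥ (p - c) - π ⬝ᵥ (p' - c)| ≤ Λ * ‖p - p'‖ := by
    have := abs_dotProduct_sub_le π (p - c) (p' - c)
    rwa [show p - c - (p' - c) = p - p' by abel] at this
  have hlin' : Λ * ‖p - p'‖ < ε / 2 := by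
    calc Λ * ‖p - p'‖ ≤ (Λ + 1) * ‖p - p'‖ :=
          mul_le_mul_of_nonneg_right (by linarith) (norm_nonneg _)
      _ < (Λ + 1) * (ε / 2 / (Λ + 1)) := mul_lt_mul_of_pos_left hd2 (by positivity)
      _ = ε / 2 := by field_simp
  calc |η p - η c - π ⬝ᵥ (p - c) - (η p' - η c - π ⬝ᵥ (p' - c))|
      = |(η p - η p') - (π ⬝ᵥ (p - c) - π ⬝ᵥ (p' - c))| := by ring_nf
    _ ≤ |η p - η p'| + |π ⬝ᵥ (p - c) - π ⬝ᵥ (p' - c)| := abs_sub _ _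
    _ < ε / 2 + ε / 2 := add_lt_add_of_lt_of_le hη' (hlin.trans hlin'.le)
    _ = ε := add_halves ε

/-- Uniform continuity of the relative entropy-flux observable `p ↦ q(p) - q(c) - π·(f(p) - f(c))`
on a set where `q` and `f` are uniformly continuous. [folklore] -/
theorem uniformContinuousOn_relFluxObs {f : (Fin n → ℝ) → (Fin n → ℝ)} {q : (Fin n → ℝ) → ℝ}
    {W : Set (Fin n → ℝ)} (hqc : UniformContinuousOn q W) (hfc : UniformContinuousOn f W)
    (c π : Fin n → ℝ) :
    UniformContinuousOn (fun p => q p - q c - π ⬝ᵥ (f p - f c)) W := by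
  set Λ : ℝ := ∑ i, |π i| with hΛ
  have hΛ0 : 0 ≤ Λ := Finset.sum_nonneg fun i _ => abs_nonneg _
  rw [Metric.uniformContinuousOn_iff]
  intro ε hε
  obtain ⟨δ₁, hδ₁, h₁⟩ := Metric.uniformContinuousOn_iff.1 hqc (ε / 2) (half_pos hε)
  obtain ⟨δ₂, hδ₂, h₂⟩ := Metric.uniformContinuousOn_iff.1 hfc (ε / 2 / (Λ + 1)) (by positivity)
  refine ⟨min δ₁ δ₂, lt_min hδ₁ hδ₂, fun p hp p' hp' hpp' => ?_⟩
  have hd1 : dist p p' < δ₁ := hpp'.trans_le (min_le_left _ _)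
  have hd2 : dist p p' < δ₂ := hpp'.trans_le (min_le_right _ _)
  have hq' : dist (q p) (q p') < ε / 2 := h₁ p hp p' hp' hd1
  have hf' : dist (f p) (f p') < ε / 2 / (Λ + 1) := h₂ p hp p' hp' hd2
  rw [Real.dist_eq] at hq' ⊢
  rw [dist_eq_norm] at hf'
  have hlin : |π ⬝ᵥ (f p - f c) - π ⬝ᵥ (f p' - f c)| ≤ Λ * ‖f p - f p'‖ := by
    have := abs_dotProduct_sub_le π (f p - f c) (f p' - f c)
    rwa [show f p - f c - (f p' - f c) = f p - f p' by abel] at this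
  have hlin' : Λ * ‖f p - f p'‖ < ε / 2 := by
    calc Λ * ‖f p - f p'‖ ≤ (Λ + 1) * ‖f p - f p'‖ :=
          mul_le_mul_of_nonneg_right (by linarith) (norm_nonneg _)
      _ < (Λ + 1) * (ε / 2 / (Λ + 1)) := mul_lt_mul_of_pos_left hf' (by positivity)
      _ = ε / 2 := by field_simp
  calc |q p - q c - π ⬝ᵥ (f p - f c) - (q p' - q c - π ⬝ᵥ (f p' - f c))|
      = |(q p - q p') - (π ⬝ᵥ (f p - f c) - π ⬝ᵥ (f p' - f c))| := by ring_nf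
    _ ≤ |q p - q p'| + |π ⬝ᵥ (f p - f c) - π ⬝ᵥ (f p' - f c)| := abs_sub _ _
    _ < ε / 2 + ε / 2 := add_lt_add_of_lt_of_le hq' (hlin.trans hlin'.le)
    _ = ε := add_halves ε

/-- Bounds for the relative quantities on a bounded set where `η, q, f` are bounded. [folklore] -/
theorem exists_bound_relObs {f : (Fin n → ℝ) → (Fin n → ℝ)} {η q : (Fin n → ℝ) → ℝ}
    {W : Set (Fin n → ℝ)} {B : ℝ} (hW : IsBounded W)
    (hB : ∀ p ∈ W, |η p| ≤ B ∧ |q p| ≤ B ∧ ‖f p‖ ≤ B) (c π : Fin n → ℝ) :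
    ∃ M, 0 ≤ M ∧ ∀ p ∈ W, |η p - η c - π ⬝ᵥ (p - c)| ≤ M ∧
      |q p - q c - π ⬝ᵥ (f p - f c)| ≤ M := by
  set Λ : ℝ := ∑ i, |π i| with hΛ
  have hΛ0 : 0 ≤ Λ := Finset.sum_nonneg fun i _ => abs_nonneg _
  obtain ⟨R, hR⟩ := hW.exists_norm_le
  rcases W.eq_empty_or_nonempty with hW0 | ⟨p₀, hp₀⟩
  · exact ⟨0, le_rfl, fun p hp => by simp [hW0] at hp⟩
  have hB0 : 0 ≤ B := (abs_nonneg _).trans (hB p₀ hp₀).1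
  have hR0 : 0 ≤ R := (norm_nonneg _).trans (hR p₀ hp₀)
  refine ⟨max (B + |η c| + Λ * (R + ‖c‖)) (B + |q c| + Λ * (B + ‖f c‖)), ?_, fun p hp => ⟨?_, ?_⟩⟩
  · exact le_max_of_le_left (by positivity)
  · refine le_trans ?_ (le_max_left _ _)
    have h1 : |π ⬝ᵥ (p - c)| ≤ Λ * (R + ‖c‖) := by
      have := abs_dotProduct_sub_le π (p - c) 0
      rw [dotProduct_zero, sub_zero, sub_zero] at this
      refine this.trans (mul_le_mul_of_nonneg_left ((norm_sub_le _ _).trans ?_) hΛ0)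
      exact add_le_add (hR p hp) le_rfl
    calc |η p - η c - π ⬝ᵥ (p - c)| ≤ |η p - η c| + |π ⬝ᵥ (p - c)| := abs_sub _ _
      _ ≤ (|η p| + |η c|) + Λ * (R + ‖c‖) := add_le_add (abs_sub _ _) h1
      _ ≤ B + |η c| + Λ * (R + ‖c‖) := by linarith [(hB p hp).1]
  · refine le_trans ?_ (le_max_right _ _)
    have h1 : |π ⬝ᵥ (f p - f c)| ≤ Λ * (B + ‖f c‖) := by
      have := abs_dotProduct_sub_le π (f p - f c) 0
      rw [dotProduct_zero, sub_zero, sub_zero] at this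
      refine this.trans (mul_le_mul_of_nonneg_left ((norm_sub_le _ _).trans ?_) hΛ0)
      exact add_le_add (hB p hp).2.2 le_rfl
    calc |q p - q c - π ⬝ᵥ (f p - f c)| ≤ |q p - q c| + |π ⬝ᵥ (f p - f c)| := abs_sub _ _
      _ ≤ (|q p| + |q c|) + Λ * (B + ‖f c‖) := add_le_add (abs_sub _ _) h1
      _ ≤ B + |q c| + Λ * (B + ‖f c‖) := by linarith [(hB p hp).2.1]

/-- **The cell inequality of §7 for the relative entropy, Lipschitz fronts.** As
`cellIneq_relEntropy`, but for merely LIPSCHITZ fronts `a < b` on `(S,T)` (Def. 1.2: "for any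
Lipschitzian curve"; the shifts `h_i` of Prop. 4.1 are Lipschitz), `u` having strong traces along
every Lipschitz curve (`HasStrongTraces u`, as for `u ∈ 𝒮_weak`): off a null set of times, for
`S < s < t < T`,
`∫_{a(t)}^{b(t)} η(u(t,x)|c) dx ≤ ∫_{a(s)}^{b(s)} η(u(s,x)|c) dx + ∫_s^t (F⁺_a - F⁻_b) dr`,
`F⁺_a = q(ua;c) - a' η(ua|c)`, `F⁻_b = q(ub;c) - b' η(ub|c)` (`a', b'` the a.e. derivatives),
where `ua` (`ub`) is the right (left) strong trace along `a` (`b`), valued in `𝒰̄₀`. Proof: smooth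
fronts `a ≤ a_j → a`, `b_j ≤ b` (`exists_smooth_approx_lipschitz`), `cellIneq_relEntropy` on
compact sub-intervals, traces along `a_j, b_j` converge to the traces along `a, b`
(`tendsto_lintegral_enorm_trace_sub_of_approx_right/left`), `a_j' → a'` a.e. (Rademacher).
[cite: ChenKrupaVasseur2022, §7 (cell estimate with fluxes `F_i^±` along the Lipschitz shifts
`h_i`), Def. 1.2, §3 (3.1)] -/
theorem cellIneq_relEntropy_lipschitz {f : (Fin n → ℝ) → (Fin n → ℝ)} {η q : (Fin n → ℝ) → ℝ}
    {U₀ : Set (Fin n → ℝ)} {u₀ : ℝ → Fin n → ℝ} {u : ℝ → ℝ → Fin n → ℝ} {a b : ℝ → ℝ}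
    {Ka Kb : ℝ≥0} {ua ub : ℝ → Fin n → ℝ} {S T B : ℝ} (c π : Fin n → ℝ) (hS : 0 ≤ S)
    (hum : Measurable (Function.uncurry u)) (huU : ∀ t x, 0 < t → u t x ∈ U₀) (hU : IsBounded U₀)
    (hηm : Measurable η) (hqm : Measurable q) (hfm : Measurable f)
    (hηc : UniformContinuousOn η (closure U₀)) (hqc : UniformContinuousOn q (closure U₀))
    (hfc : UniformContinuousOn f (closure U₀))
    (hB : ∀ p ∈ closure U₀, |η p| ≤ B ∧ |q p| ≤ B ∧ ‖f p‖ ≤ B)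
    (ha : LipschitzWith Ka a) (hb : LipschitzWith Kb b) (hab : ∀ r ∈ Ioo S T, a r < b r)
    (htr : HasStrongTraces u)
    (huam : Measurable ua) (hubm : Measurable ub) (huaW : ∀ t, ua t ∈ closure U₀)
    (hubW : ∀ t, ub t ∈ closure U₀)
    (hua : Tendsto (fun k : ℕ => ∫⁻ t in Ioo 0 T, essSup (fun y => ‖u t (a t + y) - ua t‖ₑ)
      (volume.restrict (Ioo 0 (1 / (k : ℝ))))) atTop (𝓝 0))
    (hub : Tendsto (fun k : ℕ => ∫⁻ t in Ioo 0 T, essSup (fun y => ‖u t (b t + y) - ub t‖ₑ)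
      (volume.restrict (Ioo (-(1 / (k : ℝ))) 0))) atTop (𝓝 0))
    (h31 : ∀ φ : ℝ × ℝ → ℝ, ContDiff ℝ (⊤ : ℕ∞) φ → HasCompactSupport φ → (∀ p, 0 ≤ φ p) →
      0 ≤ (∫ t in Ioi (0 : ℝ), ∫ x, (deriv (fun s => φ (s, x)) t * (η (u t x) - η c - π ⬝ᵥ (u t x - c))
          + deriv (fun y => φ (t, y)) x * (q (u t x) - q c - π ⬝ᵥ (f (u t x) - f c))))
        + ∫ x, φ (0, x) * (η (u₀ x) - η c - π ⬝ᵥ (u₀ x - c))) :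
    ∃ N : Set ℝ, volume N = 0 ∧ ∀ s t, S < s → s < t → t < T → s ∉ N → t ∉ N →
      ∫ x in a t..b t, (η (u t x) - η c - π ⬝ᵥ (u t x - c))
        ≤ (∫ x in a s..b s, (η (u s x) - η c - π ⬝ᵥ (u s x - c)))
          + ∫ r in s..t, (((q (ua r) - q c - π ⬝ᵥ (f (ua r) - f c))
                - deriv a r * (η (ua r) - η c - π ⬝ᵥ (ua r - c)))
              - ((q (ub r) - q c - π ⬝ᵥ (f (ub r) - f c))
                - deriv b r * (η (ub r) - η c - π ⬝ᵥ (ub r - c)))) := by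
  rcases le_or_gt T S with hTS | hST
  · exact ⟨∅, measure_empty, fun s t hSs hst htT _ _ => by linarith⟩
  have hT : 0 < T := hS.trans_lt hST
  set E₁ : (Fin n → ℝ) → ℝ := fun p => η p - η c - π ⬝ᵥ (p - c) with hE₁
  set E₂ : (Fin n → ℝ) → ℝ := fun p => q p - q c - π ⬝ᵥ (f p - f c) with hE₂
  have hE₁c : UniformContinuousOn E₁ (closure U₀) := uniformContinuousOn_relEntropyObs hηc c π
  have hE₂c : UniformContinuousOn E₂ (closure U₀) := uniformContinuousOn_relFluxObs hqc hfc c π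
  obtain ⟨M, hM0, hM⟩ := exists_bound_relObs hU.closure hB c π
  have hE₁b : ∀ p ∈ closure U₀, |E₁ p| ≤ M := fun p hp => (hM p hp).1
  have hE₂b : ∀ p ∈ closure U₀, |E₂ p| ≤ M := fun p hp => (hM p hp).2
  have hπc : Continuous fun p : Fin n → ℝ => π ⬝ᵥ p := continuous_const.dotProduct continuous_id
  have hE₁m : Measurable E₁ :=
    (hηm.sub measurable_const).sub (hπc.measurable.comp (measurable_id.sub measurable_const))
  have hE₂m : Measurable E₂ :=
    (hqm.sub measurable_const).sub (hπc.measurable.comp (hfm.sub measurable_const))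
  have huW : ∀ t x, 0 < t → u t x ∈ closure U₀ := fun t x ht => subset_closure (huU t x ht)
  have hKa : (0 : ℝ) ≤ Ka := Ka.2
  have hKb : (0 : ℝ) ≤ Kb := Kb.2
  have hac : Continuous a := ha.continuous
  have hbc : Continuous b := hb.continuous
  ------------------------------------------------------------------
  -- Step 1: smooth fronts `a ≤ aj j ≤ a + d j`, `b - d j ≤ bj j ≤ b`
  ------------------------------------------------------------------
  obtain ⟨ga, hga_s, hga_l, ⟨Ca, hCa⟩, hga_d⟩ := exists_smooth_approx_lipschitz ha
  obtain ⟨gb, hgb_s, hgb_l, ⟨Cb, hCb⟩, hgb_d⟩ := exists_smooth_approx_lipschitz hb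
  have hCa0 : 0 ≤ Ca := (abs_nonneg _).trans (by simpa using hCa 0 0)
  have hCb0 : 0 ≤ Cb := (abs_nonneg _).trans (by simpa using hCb 0 0)
  set aj : ℕ → ℝ → ℝ := fun j x => ga j x + Ca / ((j : ℝ) + 1) with haj
  set bj : ℕ → ℝ → ℝ := fun j x => gb j x + -(Cb / ((j : ℝ) + 1)) with hbj
  set d : ℕ → ℝ := fun j => (2 * Ca + 2 * Cb + 1) / ((j : ℝ) + 1) with hd_def
  have hj1 : ∀ j : ℕ, (0 : ℝ) < (j : ℝ) + 1 := fun j => by positivity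
  have hd0 : ∀ j, 0 < d j := fun j => by simp only [hd_def]; positivity
  have hd : Tendsto d atTop (𝓝 0) :=
    tendsto_const_nhds.div_atTop (tendsto_natCast_atTop_atTop.atTop_add tendsto_const_nhds)
  have haj_close : ∀ j t, a t ≤ aj j t ∧ aj j t ≤ a t + d j := by
    intro j t
    have h1 := hCa j t
    rw [abs_le] at h1
    simp only [haj, hd_def]
    constructor
    · linarith [h1.1]
    · have : Ca / ((j : ℝ) + 1) + Ca / ((j : ℝ) + 1) ≤ (2 * Ca + 2 * Cb + 1) / ((j : ℝ) + 1) := by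
        rw [← add_div, div_le_div_iff_of_pos_right (hj1 j)]
        linarith
      linarith [h1.2]
  have hbj_close : ∀ j t, b t - d j ≤ bj j t ∧ bj j t ≤ b t := by
    intro j t
    have h1 := hCb j t
    rw [abs_le] at h1
    simp only [hbj, hd_def]
    constructor
    · have : Cb / ((j : ℝ) + 1) + Cb / ((j : ℝ) + 1) ≤ (2 * Ca + 2 * Cb + 1) / ((j : ℝ) + 1) := by
        rw [← add_div, div_le_div_iff_of_pos_right (hj1 j)]
        linarith
      linarith [h1.1]
    · linarith [h1.2]
  have haj_s : ∀ j, ContDiff ℝ (⊤ : ℕ∞) (aj j) := fun j => (hga_s j).add contDiff_const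
  have hbj_s : ∀ j, ContDiff ℝ (⊤ : ℕ∞) (bj j) := fun j => (hgb_s j).add contDiff_const
  have haj_l : ∀ j, LipschitzWith Ka (aj j) := fun j =>
    LipschitzWith.of_dist_le_mul fun x y => by
      simp only [haj, dist_add_right]
      exact (hga_l j).dist_le_mul x y
  have hbj_l : ∀ j, LipschitzWith Kb (bj j) := fun j =>
    LipschitzWith.of_dist_le_mul fun x y => by
      simp only [hbj, dist_add_right]
      exact (hgb_l j).dist_le_mul x y
  have haj_d : ∀ j x, deriv (aj j) x = deriv (ga j) x := fun j x => by
    simp only [haj, deriv_add_const]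
  have hbj_d : ∀ j x, deriv (bj j) x = deriv (gb j) x := fun j x => by
    simp only [hbj, deriv_add_const]
  have haj_m : ∀ j, Measurable (aj j) := fun j => (haj_l j).continuous.measurable
  have hbj_m : ∀ j, Measurable (bj j) := fun j => (hbj_l j).continuous.measurable
  ------------------------------------------------------------------
  -- Step 2: closure-valued traces along the smooth fronts
  ------------------------------------------------------------------
  have hU₀ne : U₀.Nonempty := ⟨u T 0, huU T 0 hT⟩
  have hwin_r : ∀ k : ℕ, 1 ≤ k → volume (Ioo (0 : ℝ) (1 / (k : ℝ))) ≠ 0 := by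
    intro k hk
    have hk' : (0 : ℝ) < k := by exact_mod_cast hk
    rw [Real.volume_Ioo, sub_zero, Ne, ENNReal.ofReal_eq_zero, not_le]
    positivity
  have hwin_l : ∀ k : ℕ, 1 ≤ k → volume (Ioo (-(1 / (k : ℝ))) (0 : ℝ)) ≠ 0 := by
    intro k hk
    have hk' : (0 : ℝ) < k := by exact_mod_cast hk
    rw [Real.volume_Ioo, sub_neg_eq_add, zero_add, Ne, ENNReal.ofReal_eq_zero, not_le]
    positivity
  have htr_a : ∀ j, ∃ w : ℝ → Fin n → ℝ, Measurable w ∧ (∀ t, w t ∈ closure U₀) ∧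
      ∀ T', 0 < T' → Tendsto (fun k : ℕ => ∫⁻ t in Ioo 0 T',
        essSup (fun y => ‖u t (aj j t + y) - w t‖ₑ) (volume.restrict (Ioo 0 (1 / (k : ℝ)))))
        atTop (𝓝 0) := by
    intro j
    obtain ⟨um, up, -, hupm, -, hlim⟩ := htr (aj j) ⟨Ka, haj_l j⟩
    exact exists_trace_mem_closure hum (haj_m j) hupm hU₀ne huU
      (I := fun k : ℕ => Ioo (0 : ℝ) (1 / (k : ℝ))) hwin_r (fun T' hT' => (hlim T' hT').1)
  choose uaj huajm huajW huaj using htr_a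
  have htr_b : ∀ j, ∃ w : ℝ → Fin n → ℝ, Measurable w ∧ (∀ t, w t ∈ closure U₀) ∧
      ∀ T', 0 < T' → Tendsto (fun k : ℕ => ∫⁻ t in Ioo 0 T',
        essSup (fun y => ‖u t (bj j t + y) - w t‖ₑ) (volume.restrict (Ioo (-(1 / (k : ℝ))) 0)))
        atTop (𝓝 0) := by
    intro j
    obtain ⟨um, up, humm, -, -, hlim⟩ := htr (bj j) ⟨Kb, hbj_l j⟩
    exact exists_trace_mem_closure hum (hbj_m j) humm hU₀ne huU
      (I := fun k : ℕ => Ioo (-(1 / (k : ℝ))) (0 : ℝ)) hwin_l (fun T' hT' => (hlim T' hT').2)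
  choose ubj hubjm hubjW hubj using htr_b
  ------------------------------------------------------------------
  -- Step 3: the traces along `aj j`, `bj j` converge to the traces along `a`, `b` in `L¹(0,T)`
  ------------------------------------------------------------------
  have hconv_a := tendsto_lintegral_enorm_trace_sub_of_approx_right hum haj_m huajm hd0 hd
    haj_close hua (fun j => huaj j T hT)
  have hconv_b := tendsto_lintegral_enorm_trace_sub_of_approx_left hum hbj_m hubjm hd0 hd
    hbj_close hub (fun j => hubj j T hT)
  ------------------------------------------------------------------
  -- Step 4: the smooth-front cell inequalities on `(S + 1/(i+1), T - 1/(i+1))`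
  ------------------------------------------------------------------
  have hcells : ∀ i j : ℕ, ∃ Nij : Set ℝ, volume Nij = 0 ∧
      ((∀ r ∈ Ioo (S + 1 / ((i : ℝ) + 1)) (T - 1 / ((i : ℝ) + 1)), 2 * d j < b r - a r) →
        ∀ s t, S + 1 / ((i : ℝ) + 1) < s → s < t → t < T - 1 / ((i : ℝ) + 1) → s ∉ Nij → t ∉ Nij →
          ∫ x in aj j t..bj j t, E₁ (u t x) ≤ (∫ x in aj j s..bj j s, E₁ (u s x))
            + ∫ r in s..t, ((E₂ (uaj j r) - deriv (aj j) r * E₁ (uaj j r))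
                - (E₂ (ubj j r) - deriv (bj j) r * E₁ (ubj j r)))) := by
    intro i j
    by_cases hgap : ∀ r ∈ Ioo (S + 1 / ((i : ℝ) + 1)) (T - 1 / ((i : ℝ) + 1)), 2 * d j < b r - a r
    swap
    · exact ⟨∅, measure_empty, fun h => absurd h hgap⟩
    by_cases hTi : T - 1 / ((i : ℝ) + 1) ≤ S + 1 / ((i : ℝ) + 1)
    · exact ⟨∅, measure_empty, fun _ s t h1 h2 h3 _ _ => by linarith⟩
    rw [not_le] at hTi
    have hSi : 0 ≤ S + 1 / ((i : ℝ) + 1) := by positivity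
    have hTi0 : 0 < T - 1 / ((i : ℝ) + 1) := hSi.trans_lt hTi
    have habj : ∀ r ∈ Ioo (S + 1 / ((i : ℝ) + 1)) (T - 1 / ((i : ℝ) + 1)), aj j r < bj j r := by
      intro r hr
      have h1 := (haj_close j r).2
      have h2 := (hbj_close j r).1
      have h3 := hgap r hr
      linarith
    obtain ⟨N, hN, hcell⟩ := cellIneq_relEntropy (T := T - 1 / ((i : ℝ) + 1)) c π hSi hum huU hU
      hηm hqm hfm hηc hqc hfc hB (haj_s j) (hbj_s j) habj (huajm j) (hubjm j) (huajW j) (hubjW j)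
      (huaj j _ hTi0) (hubj j _ hTi0) h31
    exact ⟨N, hN, fun _ => hcell⟩
  choose Nset hNnull hNcell using hcells
  refine ⟨⋃ i, ⋃ j, Nset i j, measure_iUnion_null fun i => measure_iUnion_null fun j => hNnull i j,
    fun s t hSs hst htT hsN htN => ?_⟩
  have hs0 : 0 < s := hS.trans_lt hSs
  have ht0 : 0 < t := hs0.trans hst
  ------------------------------------------------------------------
  -- Step 5: a sub-interval `(S + 1/(i+1), T - 1/(i+1)) ∋ s, t` and the gap there
  ------------------------------------------------------------------
  obtain ⟨i, hi⟩ : ∃ i : ℕ, 1 / ((i : ℝ) + 1) < min (s - S) (T - t) := by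
    have hpos : 0 < min (s - S) (T - t) := lt_min (by linarith) (by linarith)
    obtain ⟨i, hi⟩ := exists_nat_gt (1 / min (s - S) (T - t))
    refine ⟨i, ?_⟩
    rw [div_lt_iff₀ (hj1 i)]
    rw [div_lt_iff₀ hpos] at hi
    nlinarith
  have hSi : S + 1 / ((i : ℝ) + 1) < s := by linarith [min_le_left (s - S) (T - t)]
  have hTi : t < T - 1 / ((i : ℝ) + 1) := by linarith [min_le_right (s - S) (T - t)]
  have hIccsub : Icc (S + 1 / ((i : ℝ) + 1)) (T - 1 / ((i : ℝ) + 1)) ⊆ Ioo S T := fun r hr =>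
    ⟨lt_of_lt_of_le (by linarith [one_div_pos.2 (hj1 i)]) hr.1,
      lt_of_le_of_lt hr.2 (by linarith [one_div_pos.2 (hj1 i)])⟩
  obtain ⟨m, hm0, hm⟩ : ∃ m > 0, ∀ r ∈ Icc (S + 1 / ((i : ℝ) + 1)) (T - 1 / ((i : ℝ) + 1)),
      m ≤ b r - a r := by
    obtain ⟨r₀, hr₀, hmin⟩ := (isCompact_Icc (a := S + 1 / ((i : ℝ) + 1))
      (b := T - 1 / ((i : ℝ) + 1))).exists_isMinOn ⟨s, hSi.le, (hst.trans hTi).le⟩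
      ((hbc.sub hac).continuousOn)
    exact ⟨b r₀ - a r₀, sub_pos.2 (hab r₀ (hIccsub hr₀)), fun r hr => (isMinOn_iff.1 hmin) r hr⟩
  have hjev : ∀ᶠ j in atTop, ∀ r ∈ Ioo (S + 1 / ((i : ℝ) + 1)) (T - 1 / ((i : ℝ) + 1)),
      2 * d j < b r - a r := by
    have h2d : Tendsto (fun j => 2 * d j) atTop (𝓝 0) := by simpa using hd.const_mul 2
    filter_upwards [h2d.eventually (gt_mem_nhds hm0)] with j hj r hr
    exact hj.trans_le (hm r (Ioo_subset_Icc_self hr))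
  have hineq : ∀ᶠ j in atTop, ∫ x in aj j t..bj j t, E₁ (u t x) ≤ (∫ x in aj j s..bj j s, E₁ (u s x))
      + ∫ r in s..t, ((E₂ (uaj j r) - deriv (aj j) r * E₁ (uaj j r))
          - (E₂ (ubj j r) - deriv (bj j) r * E₁ (ubj j r))) := by
    filter_upwards [hjev] with j hj
    exact hNcell i j hj s t hSi hst hTi (fun h => hsN (mem_iUnion.2 ⟨i, mem_iUnion.2 ⟨j, h⟩⟩))
      (fun h => htN (mem_iUnion.2 ⟨i, mem_iUnion.2 ⟨j, h⟩⟩))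
  ------------------------------------------------------------------
  -- Step 6: the limit `j → ∞`
  ------------------------------------------------------------------
  -- bounded measurable functions are interval integrable
  have hbi : ∀ g : ℝ → ℝ, Measurable g → ∀ C : ℝ, (∀ r, |g r| ≤ C) → ∀ p p' : ℝ,
      IntervalIntegrable g volume p p' := by
    intro g hg C hC p p'
    refine (Measure.integrableOn_of_bounded (M := C) (isCompact_uIcc.measure_lt_top.ne)
      hg.aestronglyMeasurable (ae_of_all _ fun x => ?_)).intervalIntegrable
    rw [Real.norm_eq_abs]
    exact hC x
  have hslice : ∀ r, 0 < r → ∀ p p' : ℝ, IntervalIntegrable (fun x => E₁ (u r x)) volume p p' :=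
    fun r hr => hbi _ (hE₁m.comp hum.of_uncurry_left) M fun x => hE₁b _ (huW r x hr)
  -- (6a) the cell integrals converge
  have hI : ∀ r, 0 < r → Tendsto (fun j => ∫ x in aj j r..bj j r, E₁ (u r x)) atTop
      (𝓝 (∫ x in a r..b r, E₁ (u r x))) := by
    intro r hr
    refine tendsto_iff_norm_sub_tendsto_zero.2 ?_
    have hbound : ∀ j, ‖(∫ x in aj j r..bj j r, E₁ (u r x)) - ∫ x in a r..b r, E₁ (u r x)‖
        ≤ 2 * M * d j := by
      intro j
      have e1 := intervalIntegral.integral_add_adjacent_intervals (hslice r hr (aj j r) (a r))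
        (hslice r hr (a r) (bj j r))
      have e2 := intervalIntegral.integral_add_adjacent_intervals (hslice r hr (a r) (b r))
        (hslice r hr (b r) (bj j r))
      have e : (∫ x in aj j r..bj j r, E₁ (u r x)) - ∫ x in a r..b r, E₁ (u r x)
          = (∫ x in aj j r..a r, E₁ (u r x)) + ∫ x in b r..bj j r, E₁ (u r x) := by linarith
      rw [e]
      have h1 : ‖∫ x in aj j r..a r, E₁ (u r x)‖ ≤ M * |a r - aj j r| :=
        intervalIntegral.norm_integral_le_of_norm_le_const fun x _ => by
          rw [Real.norm_eq_abs]; exact hE₁b _ (huW r x hr)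
      have h2 : ‖∫ x in b r..bj j r, E₁ (u r x)‖ ≤ M * |bj j r - b r| :=
        intervalIntegral.norm_integral_le_of_norm_le_const fun x _ => by
          rw [Real.norm_eq_abs]; exact hE₁b _ (huW r x hr)
      have h3 : |a r - aj j r| ≤ d j := by
        rw [abs_sub_comm, abs_of_nonneg (by linarith [(haj_close j r).1])]
        linarith [(haj_close j r).2]
      have h4 : |bj j r - b r| ≤ d j := by
        rw [abs_of_nonpos (by linarith [(hbj_close j r).2])]
        linarith [(hbj_close j r).1]
      calc ‖(∫ x in aj j r..a r, E₁ (u r x)) + ∫ x in b r..bj j r, E₁ (u r x)‖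
          ≤ ‖∫ x in aj j r..a r, E₁ (u r x)‖ + ‖∫ x in b r..bj j r, E₁ (u r x)‖ := norm_add_le _ _
        _ ≤ M * d j + M * d j :=
            add_le_add (h1.trans (mul_le_mul_of_nonneg_left h3 hM0))
              (h2.trans (mul_le_mul_of_nonneg_left h4 hM0))
        _ = 2 * M * d j := by ring
    have hlim : Tendsto (fun j => 2 * M * d j) atTop (𝓝 0) := by simpa using hd.const_mul (2 * M)
    exact squeeze_zero (fun j => norm_nonneg _) hbound hlim
  -- (6b) ingredients: the six error terms tend to zero
  have hIoc : Ioc s t ⊆ Ioo 0 T := fun r hr => ⟨hs0.trans hr.1, hr.2.trans_lt htT⟩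
  have hvol : volume (Ioo (0 : ℝ) T) ≠ ⊤ := by rw [Real.volume_Ioo]; exact ENNReal.ofReal_ne_top
  have hT1 := tendsto_lintegral_enorm_comp_sub_of_uniformContinuousOn hE₂c hE₂b huaW huajW hvol hconv_a
  have hT2 := tendsto_lintegral_enorm_comp_sub_of_uniformContinuousOn hE₁c hE₁b huaW huajW hvol hconv_a
  have hT4 := tendsto_lintegral_enorm_comp_sub_of_uniformContinuousOn hE₂c hE₂b hubW hubjW hvol hconv_b
  have hT5 := tendsto_lintegral_enorm_comp_sub_of_uniformContinuousOn hE₁c hE₁b hubW hubjW hvol hconv_b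
  -- from `∫⁻` over `(0,T)` to `∫ s..t` of the absolute value
  have hreal : ∀ {g : ℕ → ℝ → ℝ}, (∀ j, Measurable (g j)) →
      Tendsto (fun j => ∫⁻ r in Ioo 0 T, ‖g j r‖ₑ) atTop (𝓝 0) →
      Tendsto (fun j => ∫ r in s..t, |g j r|) atTop (𝓝 0) := by
    intro g hgm hg
    have h1 : Tendsto (fun j => ∫⁻ r in Ioc s t, ‖g j r‖ₑ) atTop (𝓝 0) :=
      tendsto_of_tendsto_of_tendsto_of_le_of_le' tendsto_const_nhds hg
        (Eventually.of_forall fun j => zero_le) (Eventually.of_forall fun j => lintegral_mono_set hIoc)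
    have h2 := (ENNReal.tendsto_toReal ENNReal.zero_ne_top).comp h1
    rw [ENNReal.toReal_zero] at h2
    refine h2.congr fun j => ?_
    rw [Function.comp_apply, intervalIntegral.integral_of_le hst.le,
      ← integral_norm_eq_lintegral_enorm (hgm j).aestronglyMeasurable]
    rfl
  have hT1r : Tendsto (fun j => ∫ r in s..t, |E₂ (uaj j r) - E₂ (ua r)|) atTop (𝓝 0) :=
    hreal (fun j => (hE₂m.comp (huajm j)).sub (hE₂m.comp huam)) hT1
  have hT2r : Tendsto (fun j => ∫ r in s..t, |E₁ (uaj j r) - E₁ (ua r)|) atTop (𝓝 0) :=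
    hreal (fun j => (hE₁m.comp (huajm j)).sub (hE₁m.comp huam)) hT2
  have hT4r : Tendsto (fun j => ∫ r in s..t, |E₂ (ubj j r) - E₂ (ub r)|) atTop (𝓝 0) :=
    hreal (fun j => (hE₂m.comp (hubjm j)).sub (hE₂m.comp hubm)) hT4
  have hT5r : Tendsto (fun j => ∫ r in s..t, |E₁ (ubj j r) - E₁ (ub r)|) atTop (𝓝 0) :=
    hreal (fun j => (hE₁m.comp (hubjm j)).sub (hE₁m.comp hubm)) hT5
  -- the derivative terms: dominated convergence on `[s,t]` (Rademacher for `a`, `b`)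
  haveI hfin : IsFiniteMeasure (volume.restrict (Ioc s t)) :=
    ⟨by rw [Measure.restrict_apply_univ]; exact measure_Ioc_lt_top⟩
  have hderiv : ∀ {g : ℝ → ℝ} {gj : ℕ → ℝ → ℝ} {K : ℝ≥0}, LipschitzWith K g →
      (∀ j, LipschitzWith K (gj j)) →
      (∀ x, DifferentiableAt ℝ g x → Tendsto (fun j => deriv (gj j) x) atTop (𝓝 (deriv g x))) →
      Tendsto (fun j => ∫ r in s..t, |deriv (gj j) r - deriv g r|) atTop (𝓝 0) := by
    intro g gj K hg hgj hconv
    have hK0 : (0 : ℝ) ≤ K := K.2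
    simp_rw [intervalIntegral.integral_of_le hst.le]
    have hlim := tendsto_integral_of_dominated_convergence (μ := volume.restrict (Ioc s t))
      (F := fun j r => |deriv (gj j) r - deriv g r|) (f := fun _ => (0 : ℝ)) (fun _ => (K : ℝ) + K)
      (fun j => (((measurable_deriv (gj j)).sub (measurable_deriv g)).norm).aestronglyMeasurable)
      (integrable_const _) (fun j => ae_of_all _ fun r => ?_) ?_
    · simpa using hlim
    · rw [Real.norm_eq_abs, abs_abs]
      have h1 := norm_deriv_le_of_lipschitz (x₀ := r) (hgj j)
      have h2 := norm_deriv_le_of_lipschitz (x₀ := r) hg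
      rw [Real.norm_eq_abs] at h1 h2
      exact (abs_sub _ _).trans (add_le_add h1 h2)
    · filter_upwards [ae_restrict_of_ae (hg.ae_differentiableAt_real)] with r hr
      have := ((hconv r hr).sub_const (deriv g r)).abs
      simpa using this
  have hT3r := hderiv ha hga_l hga_d
  have hT6r := hderiv hb hgb_l hgb_d
  -- bounds on the derivatives
  have hda : ∀ j r, |deriv (ga j) r| ≤ Ka := fun j r => by
    have := norm_deriv_le_of_lipschitz (x₀ := r) (hga_l j); rwa [Real.norm_eq_abs] at this
  have hda0 : ∀ r, |deriv a r| ≤ Ka := fun r => by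
    have := norm_deriv_le_of_lipschitz (x₀ := r) ha; rwa [Real.norm_eq_abs] at this
  have hdb : ∀ j r, |deriv (gb j) r| ≤ Kb := fun j r => by
    have := norm_deriv_le_of_lipschitz (x₀ := r) (hgb_l j); rwa [Real.norm_eq_abs] at this
  have hdb0 : ∀ r, |deriv b r| ≤ Kb := fun r => by
    have := norm_deriv_le_of_lipschitz (x₀ := r) hb; rwa [Real.norm_eq_abs] at this
  -- the fluxes and the error majorant
  set Φj : ℕ → ℝ → ℝ := fun j r => (E₂ (uaj j r) - deriv (ga j) r * E₁ (uaj j r))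
    - (E₂ (ubj j r) - deriv (gb j) r * E₁ (ubj j r)) with hΦj
  set Φ : ℝ → ℝ := fun r => (E₂ (ua r) - deriv a r * E₁ (ua r))
    - (E₂ (ub r) - deriv b r * E₁ (ub r)) with hΦ
  set R : ℕ → ℝ → ℝ := fun j r => (|E₂ (uaj j r) - E₂ (ua r)|
    + ((Ka : ℝ) * |E₁ (uaj j r) - E₁ (ua r)| + M * |deriv (ga j) r - deriv a r|))
    + (|E₂ (ubj j r) - E₂ (ub r)|
    + ((Kb : ℝ) * |E₁ (ubj j r) - E₁ (ub r)| + M * |deriv (gb j) r - deriv b r|)) with hR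
  have hptR : ∀ j r, |Φj j r - Φ r| ≤ R j r := by
    intro j r
    have h1 : |deriv (ga j) r * E₁ (uaj j r) - deriv a r * E₁ (ua r)|
        ≤ (Ka : ℝ) * |E₁ (uaj j r) - E₁ (ua r)| + M * |deriv (ga j) r - deriv a r| := by
      have e : deriv (ga j) r * E₁ (uaj j r) - deriv a r * E₁ (ua r)
          = deriv (ga j) r * (E₁ (uaj j r) - E₁ (ua r)) + (deriv (ga j) r - deriv a r) * E₁ (ua r) := by
        ring
      rw [e]
      refine (abs_add_le _ _).trans (add_le_add ?_ ?_)
      · rw [abs_mul]; exact mul_le_mul_of_nonneg_right (hda j r) (abs_nonneg _)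
      · rw [abs_mul, mul_comm]; exact mul_le_mul_of_nonneg_right (hE₁b _ (huaW r)) (abs_nonneg _)
    have h2 : |deriv (gb j) r * E₁ (ubj j r) - deriv b r * E₁ (ub r)|
        ≤ (Kb : ℝ) * |E₁ (ubj j r) - E₁ (ub r)| + M * |deriv (gb j) r - deriv b r| := by
      have e : deriv (gb j) r * E₁ (ubj j r) - deriv b r * E₁ (ub r)
          = deriv (gb j) r * (E₁ (ubj j r) - E₁ (ub r)) + (deriv (gb j) r - deriv b r) * E₁ (ub r) := by
        ring
      rw [e]
      refine (abs_add_le _ _).trans (add_le_add ?_ ?_)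
      · rw [abs_mul]; exact mul_le_mul_of_nonneg_right (hdb j r) (abs_nonneg _)
      · rw [abs_mul, mul_comm]; exact mul_le_mul_of_nonneg_right (hE₁b _ (hubW r)) (abs_nonneg _)
    have e : Φj j r - Φ r = ((E₂ (uaj j r) - E₂ (ua r))
        - (deriv (ga j) r * E₁ (uaj j r) - deriv a r * E₁ (ua r)))
        - ((E₂ (ubj j r) - E₂ (ub r)) - (deriv (gb j) r * E₁ (ubj j r) - deriv b r * E₁ (ub r))) := by
      simp only [hΦj, hΦ]; ring
    rw [e]
    simp only [hR]
    refine (abs_sub _ _).trans (add_le_add ((abs_sub _ _).trans (add_le_add le_rfl h1))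
      ((abs_sub _ _).trans (add_le_add le_rfl h2)))
  -- measurability and bounds
  have hmE₁a : ∀ j, Measurable fun r => E₁ (uaj j r) := fun j => hE₁m.comp (huajm j)
  have hmE₂a : ∀ j, Measurable fun r => E₂ (uaj j r) := fun j => hE₂m.comp (huajm j)
  have hmE₁b : ∀ j, Measurable fun r => E₁ (ubj j r) := fun j => hE₁m.comp (hubjm j)
  have hmE₂b : ∀ j, Measurable fun r => E₂ (ubj j r) := fun j => hE₂m.comp (hubjm j)
  have hmE₁a0 : Measurable fun r => E₁ (ua r) := hE₁m.comp huam
  have hmE₂a0 : Measurable fun r => E₂ (ua r) := hE₂m.comp huam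
  have hmE₁b0 : Measurable fun r => E₁ (ub r) := hE₁m.comp hubm
  have hmE₂b0 : Measurable fun r => E₂ (ub r) := hE₂m.comp hubm
  have hΦjm : ∀ j, Measurable (Φj j) := fun j =>
    ((hmE₂a j).sub ((measurable_deriv _).mul (hmE₁a j))).sub
      ((hmE₂b j).sub ((measurable_deriv _).mul (hmE₁b j)))
  have hΦm : Measurable Φ :=
    (hmE₂a0.sub ((measurable_deriv _).mul hmE₁a0)).sub (hmE₂b0.sub ((measurable_deriv _).mul hmE₁b0))
  have hMK : ∀ (K : ℝ≥0) (y z w : ℝ), |y| ≤ K → |z| ≤ M → |w| ≤ M → |z - y * w| ≤ M + K * M := by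
    intro K y z w hy hz hw
    calc |z - y * w| ≤ |z| + |y * w| := abs_sub _ _
      _ ≤ M + K * M := by
        rw [abs_mul]; exact add_le_add hz (mul_le_mul hy hw (abs_nonneg _) K.2)
  have hΦjb : ∀ j r, |Φj j r| ≤ (M + Ka * M) + (M + Kb * M) := fun j r =>
    (abs_sub _ _).trans (add_le_add (hMK Ka _ _ _ (hda j r) (hE₂b _ (huajW j r)) (hE₁b _ (huajW j r)))
      (hMK Kb _ _ _ (hdb j r) (hE₂b _ (hubjW j r)) (hE₁b _ (hubjW j r))))
  have hΦb : ∀ r, |Φ r| ≤ (M + Ka * M) + (M + Kb * M) := fun r =>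
    (abs_sub _ _).trans (add_le_add (hMK Ka _ _ _ (hda0 r) (hE₂b _ (huaW r)) (hE₁b _ (huaW r)))
      (hMK Kb _ _ _ (hdb0 r) (hE₂b _ (hubW r)) (hE₁b _ (hubW r))))
  have hΦji : ∀ j, IntervalIntegrable (Φj j) volume s t := fun j => hbi _ (hΦjm j) _ (hΦjb j) s t
  have hΦi : IntervalIntegrable Φ volume s t := hbi _ hΦm _ hΦb s t
  -- the six pieces of `R j`
  have hdiff2 : ∀ {g₁ g₂ : ℝ → ℝ}, Measurable g₁ → Measurable g₂ → ∀ C, (∀ r, |g₁ r| ≤ C) →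
      (∀ r, |g₂ r| ≤ C) → ∀ (L : ℝ), IntervalIntegrable (fun r => L * |g₁ r - g₂ r|) volume s t := by
    intro g₁ g₂ h1 h2 C hC1 hC2 L
    have hm : Measurable fun r => L * |g₁ r - g₂ r| := measurable_const.mul ((h1.sub h2).norm)
    refine hbi _ hm (|L| * (C + C)) (fun r => ?_) s t
    rw [abs_mul, abs_abs]
    exact mul_le_mul_of_nonneg_left ((abs_sub _ _).trans (add_le_add (hC1 r) (hC2 r))) (abs_nonneg _)
  have i1 : ∀ j, IntervalIntegrable (fun r => |E₂ (uaj j r) - E₂ (ua r)|) volume s t := fun j => by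
    simpa using hdiff2 (hmE₂a j) hmE₂a0 M (fun r => hE₂b _ (huajW j r)) (fun r => hE₂b _ (huaW r)) 1
  have i2 : ∀ j, IntervalIntegrable (fun r => (Ka : ℝ) * |E₁ (uaj j r) - E₁ (ua r)|) volume s t :=
    fun j => hdiff2 (hmE₁a j) hmE₁a0 M (fun r => hE₁b _ (huajW j r)) (fun r => hE₁b _ (huaW r)) _
  have i3 : ∀ j, IntervalIntegrable (fun r => M * |deriv (ga j) r - deriv a r|) volume s t :=
    fun j => hdiff2 (measurable_deriv _) (measurable_deriv _) Ka (hda j) hda0 _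
  have i4 : ∀ j, IntervalIntegrable (fun r => |E₂ (ubj j r) - E₂ (ub r)|) volume s t := fun j => by
    simpa using hdiff2 (hmE₂b j) hmE₂b0 M (fun r => hE₂b _ (hubjW j r)) (fun r => hE₂b _ (hubW r)) 1
  have i5 : ∀ j, IntervalIntegrable (fun r => (Kb : ℝ) * |E₁ (ubj j r) - E₁ (ub r)|) volume s t :=
    fun j => hdiff2 (hmE₁b j) hmE₁b0 M (fun r => hE₁b _ (hubjW j r)) (fun r => hE₁b _ (hubW r)) _
  have i6 : ∀ j, IntervalIntegrable (fun r => M * |deriv (gb j) r - deriv b r|) volume s t :=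
    fun j => hdiff2 (measurable_deriv _) (measurable_deriv _) Kb (hdb j) hdb0 _
  have i23 : ∀ j, IntervalIntegrable (fun r => (Ka : ℝ) * |E₁ (uaj j r) - E₁ (ua r)|
      + M * |deriv (ga j) r - deriv a r|) volume s t := fun j => (i2 j).add (i3 j)
  have i56 : ∀ j, IntervalIntegrable (fun r => (Kb : ℝ) * |E₁ (ubj j r) - E₁ (ub r)|
      + M * |deriv (gb j) r - deriv b r|) volume s t := fun j => (i5 j).add (i6 j)
  have iA : ∀ j, IntervalIntegrable (fun r => |E₂ (uaj j r) - E₂ (ua r)|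
      + ((Ka : ℝ) * |E₁ (uaj j r) - E₁ (ua r)| + M * |deriv (ga j) r - deriv a r|)) volume s t :=
    fun j => (i1 j).add (i23 j)
  have iB : ∀ j, IntervalIntegrable (fun r => |E₂ (ubj j r) - E₂ (ub r)|
      + ((Kb : ℝ) * |E₁ (ubj j r) - E₁ (ub r)| + M * |deriv (gb j) r - deriv b r|)) volume s t :=
    fun j => (i4 j).add (i56 j)
  have hRi : ∀ j, IntervalIntegrable (R j) volume s t := fun j => (iA j).add (iB j)
  have hRlim : Tendsto (fun j => ∫ r in s..t, R j r) atTop (𝓝 0) := by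
    have e : ∀ j, ∫ r in s..t, R j r = ((∫ r in s..t, |E₂ (uaj j r) - E₂ (ua r)|)
        + ((Ka : ℝ) * (∫ r in s..t, |E₁ (uaj j r) - E₁ (ua r)|)
          + M * ∫ r in s..t, |deriv (ga j) r - deriv a r|))
        + ((∫ r in s..t, |E₂ (ubj j r) - E₂ (ub r)|)
        + ((Kb : ℝ) * (∫ r in s..t, |E₁ (ubj j r) - E₁ (ub r)|)
          + M * ∫ r in s..t, |deriv (gb j) r - deriv b r|)) := by
      intro j
      simp only [hR]
      rw [intervalIntegral.integral_add (iA j) (iB j), intervalIntegral.integral_add (i1 j) (i23 j),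
        intervalIntegral.integral_add (i2 j) (i3 j), intervalIntegral.integral_add (i4 j) (i56 j),
        intervalIntegral.integral_add (i5 j) (i6 j), intervalIntegral.integral_const_mul,
        intervalIntegral.integral_const_mul, intervalIntegral.integral_const_mul,
        intervalIntegral.integral_const_mul]
    simp_rw [e]
    have := (hT1r.add ((hT2r.const_mul (Ka : ℝ)).add (hT3r.const_mul M))).add
      (hT4r.add ((hT5r.const_mul (Kb : ℝ)).add (hT6r.const_mul M)))
    simpa using this
  -- the flux integrals converge
  have hΦlim : Tendsto (fun j => ∫ r in s..t, Φj j r) atTop (𝓝 (∫ r in s..t, Φ r)) := by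
    refine tendsto_iff_norm_sub_tendsto_zero.2
      (squeeze_zero (fun j => norm_nonneg _) (fun j => ?_) hRlim)
    rw [← intervalIntegral.integral_sub (hΦji j) hΦi]
    refine (intervalIntegral.norm_integral_le_integral_norm hst.le).trans ?_
    refine intervalIntegral.integral_mono_on hst.le ((hΦji j).sub hΦi).norm (hRi j) fun r _ => ?_
    rw [Real.norm_eq_abs]
    exact hptR j r
  -- (6c) conclusion
  have hineq' : ∀ᶠ j in atTop, (∫ x in aj j t..bj j t, E₁ (u t x))
      ≤ (∫ x in aj j s..bj j s, E₁ (u s x)) + ∫ r in s..t, Φj j r := by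
    filter_upwards [hineq] with j hj
    simp only [hΦj]
    simpa only [haj_d, hbj_d] using hj
  exact le_of_tendsto_of_tendsto (hI t ht0) ((hI s hs0).add hΦlim) hineq'

end LipschitzFrontsMain

end Literature.Analysis.PDE
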